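import Mathlib
import HarnessLib
import Summits.Ventures.LatticeQCDFlow.Exactness.FTHMCWordCovariance
import Summits.Ventures.LatticeQCDFlow.Exactness.SU2ExactForceCovariance

/-!
# The `SU(2)` FT-HMC kernel with the engine's OMF2 integrator commutes with every gauge transformation — with the exact-gradient forces, no force hypothesis left

HONEST FRAMING: exact (Metropolis-corrected) sampling algorithms for lattice gauge theory;
figures of merit are autocorrelation/cost numbers at stated couplings and volumes; no
continuum-physics claim.

Venture `LatticeQCDFlow` (cell pub-lqcd), topic `Exactness`; FANOUT row 14 (`eng-flowhmc`, engine
`latflow.fthmc`, integrator menu `leapfrog | omf2 | omf4`; the OMF words are row 9's `omf2Word` /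
`omf4Word`, typed as exact on the `SU(2)` rung in GEN-8's `SU2FTHMCIntegrators`).  NEW WORK of the
cell; nothing is cited as a fact; no number.  `SU2FTHMCGaugeCovariance` (leapfrog) extended to the
whole integrator menu through `FTHMCWordCovariance.gauge_fthmc_omf2/omf4_conjKernel_eq_self`:

* **`su2_fthmc_omf2_conjKernel_gaugeTransform`** — the OMF2 kernel of `su2_fthmc_omf2_gaussian_exact`
  (word `K_{g₁} D_c K_{g₂} D_c K_{g₁}`, quaternion exponential drift of constant `c`, member `F`
  gauge equivariant, booked density `J` and action `S` gauge invariant and measurable) commutes with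
  `Θ_h` for every `h : Λ → SU(2)` whenever BOTH force routines are covariant;
* **`su2_fthmc_omf2_exactForce_conjKernel_gaugeTransform`** — with the engine's forces, i.e. real
  multiples `κ₁`, `κ₂` of the EXACT gradient of the pulled-back action `S̃ = S∘F − log J` along the
  drift (`SU2ExactForceCovariance`: covariant for every gauge-invariant `S̃`, measurable for
  continuous `S̃`): NO hypothesis on the forces is left.

The OMF4 integrator is the sequel `SU2FTHMCOmf4Covariance.lean`.

NOT CLAIMED: floating point; `SU(N ≥ 3)`; any number.
-/

noncomputable section

namespace Summit.Ventures.LatticeQCDFlow.Exactness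

open WithLp Set MeasureTheory
open ProbabilityTheory ProbabilityTheory.Kernel
open Literature.MathematicalPhysics.QuantumFieldTheory Literature.Barriers.QuantumFields
open scoped ENNReal Matrix

variable {d L : ℕ} [NeZero L]

/-! ## OMF2 -/

/-- **The `SU(2)` FT-HMC kernel with the OMF2 integrator commutes with every gauge transformation**
(equivariant member, invariant measurable `J` and `S`, BOTH force routines covariant, any `c`, `n`). -/
theorem su2_fthmc_omf2_conjKernel_gaugeTransform (h : Site d L → Matrix.specialUnitaryGroup (Fin 2) ℂ)
    (F : GaugeConfig d L (Matrix.specialUnitaryGroup (Fin 2) ℂ) ≃ᵐ GaugeConfig d L (Matrix.specialUnitaryGroup (Fin 2) ℂ)) (hF : IsGaugeEquivariant (⇑F))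
    {J : GaugeConfig d L (Matrix.specialUnitaryGroup (Fin 2) ℂ) → ℝ} (hJm : Measurable J) (hJ : IsGaugeInvariant J)
    {S : GaugeConfig d L (Matrix.specialUnitaryGroup (Fin 2) ℂ) → ℝ} (hS : Measurable S) (hSi : IsGaugeInvariant S) (c : ℝ)
    {g₁ g₂ : GaugeConfig d L (Matrix.specialUnitaryGroup (Fin 2) ℂ) → ((Edge d L × Fin 3) → ℝ)} (hg₁ : Measurable g₁) (hg₂ : Measurable g₂)
    (hgc₁ : ∀ V : GaugeConfig d L (Matrix.specialUnitaryGroup (Fin 2) ℂ), g₁ (gaugeTransform h V) =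
      (fun q : Edge d L × Fin 3 => (vecQuat (((h q.1.1 : Matrix.specialUnitaryGroup (Fin 2) ℂ) : Matrix (Fin 2) (Fin 2) ℂ) * quatVec (toLp 2 ![0, g₁ V (q.1, 0), g₁ V (q.1, 1), g₁ V (q.1, 2)]) * (((h q.1.1 : Matrix.specialUnitaryGroup (Fin 2) ℂ) : Matrix (Fin 2) (Fin 2) ℂ))ᴴ)) q.2.succ))
    (hgc₂ : ∀ V : GaugeConfig d L (Matrix.specialUnitaryGroup (Fin 2) ℂ), g₂ (gaugeTransform h V) =
      (fun q : Edge d L × Fin 3 => (vecQuat (((h q.1.1 : Matrix.specialUnitaryGroup (Fin 2) ℂ) : Matrix (Fin 2) (Fin 2) ℂ) * quatVec (toLp 2 ![0, g₂ V (q.1, 0), g₂ V (q.1, 1), g₂ V (q.1, 2)]) * (((h q.1.1 : Matrix.specialUnitaryGroup (Fin 2) ℂ) : Matrix (Fin 2) (Fin 2) ℂ))ᴴ)) q.2.succ)) (n : ℕ) :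
    conjKernel
      (conjKernel
        (refreshUpdate
          (involMH
            (⇑((flip : Equiv.Perm (GaugeConfig d L (Matrix.specialUnitaryGroup (Fin 2) ℂ) × ((Edge d L × Fin 3) → ℝ))) *
                omf2Word g₁ (mulDrift fun q : ((Edge d L × Fin 3) → ℝ) =>
                    fun ℓ : Edge d L => gaussUnit (toLp 2
          ![Real.cos (c * Real.sqrt (q (ℓ, 0) ^ 2 + q (ℓ, 1) ^ 2 + q (ℓ, 2) ^ 2)),
            c * Real.sinc (c * Real.sqrt (q (ℓ, 0) ^ 2 + q (ℓ, 1) ^ 2 + q (ℓ, 2) ^ 2)) * q (ℓ, 0),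
            c * Real.sinc (c * Real.sqrt (q (ℓ, 0) ^ 2 + q (ℓ, 1) ^ 2 + q (ℓ, 2) ^ 2)) * q (ℓ, 1),
            c * Real.sinc (c * Real.sqrt (q (ℓ, 0) ^ 2 + q (ℓ, 1) ^ 2 + q (ℓ, 2) ^ 2)) * q (ℓ, 2)])) g₂ ^ n))
            (measurable_flip_omf2Word_pow (measurable_su2Drift c) hg₁ hg₂ n)
            fun z : GaugeConfig d L (Matrix.specialUnitaryGroup (Fin 2) ℂ) × ((Edge d L × Fin 3) → ℝ) => (S (F z.1) - Real.log (J z.1)) + ∑ i, z.2 i ^ 2 / 2)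
          ((((volume : Measure ((Edge d L × Fin 3) → ℝ)).withDensity
                  fun p => ENNReal.ofReal (Real.exp (-(∑ i, p i ^ 2 / 2)))) Set.univ)⁻¹ •
              (volume : Measure ((Edge d L × Fin 3) → ℝ)).withDensity
                fun p => ENNReal.ofReal (Real.exp (-(∑ i, p i ^ 2 / 2)))))
        F)
      (Elitzur.gaugeTransformMEquiv h) =
      (conjKernel
        (refreshUpdate
          (involMH
            (⇑((flip : Equiv.Perm (GaugeConfig d L (Matrix.specialUnitaryGroup (Fin 2) ℂ) × ((Edge d L × Fin 3) → ℝ))) *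
                omf2Word g₁ (mulDrift fun q : ((Edge d L × Fin 3) → ℝ) =>
                    fun ℓ : Edge d L => gaussUnit (toLp 2
          ![Real.cos (c * Real.sqrt (q (ℓ, 0) ^ 2 + q (ℓ, 1) ^ 2 + q (ℓ, 2) ^ 2)),
            c * Real.sinc (c * Real.sqrt (q (ℓ, 0) ^ 2 + q (ℓ, 1) ^ 2 + q (ℓ, 2) ^ 2)) * q (ℓ, 0),
            c * Real.sinc (c * Real.sqrt (q (ℓ, 0) ^ 2 + q (ℓ, 1) ^ 2 + q (ℓ, 2) ^ 2)) * q (ℓ, 1),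
            c * Real.sinc (c * Real.sqrt (q (ℓ, 0) ^ 2 + q (ℓ, 1) ^ 2 + q (ℓ, 2) ^ 2)) * q (ℓ, 2)])) g₂ ^ n))
            (measurable_flip_omf2Word_pow (measurable_su2Drift c) hg₁ hg₂ n)
            fun z : GaugeConfig d L (Matrix.specialUnitaryGroup (Fin 2) ℂ) × ((Edge d L × Fin 3) → ℝ) => (S (F z.1) - Real.log (J z.1)) + ∑ i, z.2 i ^ 2 / 2)
          ((((volume : Measure ((Edge d L × Fin 3) → ℝ)).withDensity
                  fun p => ENNReal.ofReal (Real.exp (-(∑ i, p i ^ 2 / 2)))) Set.univ)⁻¹ •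
              (volume : Measure ((Edge d L × Fin 3) → ℝ)).withDensity
                fun p => ENNReal.ofReal (Real.exp (-(∑ i, p i ^ 2 / 2)))))
        F) := by
  let R : ((Edge d L × Fin 3) → ℝ) ≃ᵐ ((Edge d L × Fin 3) → ℝ) :=
    { toFun := fun p => (fun q : Edge d L × Fin 3 => (vecQuat (((h q.1.1 : Matrix.specialUnitaryGroup (Fin 2) ℂ) : Matrix (Fin 2) (Fin 2) ℂ) * quatVec (toLp 2 ![0, p (q.1, 0), p (q.1, 1), p (q.1, 2)]) * (((h q.1.1 : Matrix.specialUnitaryGroup (Fin 2) ℂ) : Matrix (Fin 2) (Fin 2) ℂ))ᴴ)) q.2.succ)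
      invFun := fun p => (fun q : Edge d L × Fin 3 => (vecQuat (((h⁻¹ q.1.1 : Matrix.specialUnitaryGroup (Fin 2) ℂ) : Matrix (Fin 2) (Fin 2) ℂ) * quatVec (toLp 2 ![0, p (q.1, 0), p (q.1, 1), p (q.1, 2)]) * (((h⁻¹ q.1.1 : Matrix.specialUnitaryGroup (Fin 2) ℂ) : Matrix (Fin 2) (Fin 2) ℂ))ᴴ)) q.2.succ)
      left_inv := fun p => su2MomRot_inv_left h p
      right_inv := fun p => su2MomRot_inv_right h p
      measurable_toFun := measurable_su2MomRot h
      measurable_invFun := measurable_su2MomRot h⁻¹ }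
  have hRapply : ∀ p, R p = (fun q : Edge d L × Fin 3 => (vecQuat (((h q.1.1 : Matrix.specialUnitaryGroup (Fin 2) ℂ) : Matrix (Fin 2) (Fin 2) ℂ) * quatVec (toLp 2 ![0, p (q.1, 0), p (q.1, 1), p (q.1, 2)]) * (((h q.1.1 : Matrix.specialUnitaryGroup (Fin 2) ℂ) : Matrix (Fin 2) (Fin 2) ℂ))ᴴ)) q.2.succ) := fun p => rfl
  have hRneg : ∀ p, R (-p) = -R p := fun p => by
    rw [hRapply, hRapply]
    exact su2MomRot_neg h p
  have hRadd : ∀ p p', R (p + p') = R p + R p' := fun p p' => by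
    rw [hRapply, hRapply, hRapply]
    exact su2MomRot_add h p p'
  have he : ∀ (c' : ℝ) (p : ((Edge d L × Fin 3) → ℝ)) (V : GaugeConfig d L (Matrix.specialUnitaryGroup (Fin 2) ℂ)),
      (fun q : ((Edge d L × Fin 3) → ℝ) =>
                    fun ℓ : Edge d L => gaussUnit (toLp 2
          ![Real.cos (c' * Real.sqrt (q (ℓ, 0) ^ 2 + q (ℓ, 1) ^ 2 + q (ℓ, 2) ^ 2)),
            c' * Real.sinc (c' * Real.sqrt (q (ℓ, 0) ^ 2 + q (ℓ, 1) ^ 2 + q (ℓ, 2) ^ 2)) * q (ℓ, 0),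
            c' * Real.sinc (c' * Real.sqrt (q (ℓ, 0) ^ 2 + q (ℓ, 1) ^ 2 + q (ℓ, 2) ^ 2)) * q (ℓ, 1),
            c' * Real.sinc (c' * Real.sqrt (q (ℓ, 0) ^ 2 + q (ℓ, 1) ^ 2 + q (ℓ, 2) ^ 2)) * q (ℓ, 2)])) (R p) * (Elitzur.gaugeTransformMEquiv h) V =
        (Elitzur.gaugeTransformMEquiv h) ((fun q : ((Edge d L × Fin 3) → ℝ) =>
                    fun ℓ : Edge d L => gaussUnit (toLp 2
          ![Real.cos (c' * Real.sqrt (q (ℓ, 0) ^ 2 + q (ℓ, 1) ^ 2 + q (ℓ, 2) ^ 2)),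
            c' * Real.sinc (c' * Real.sqrt (q (ℓ, 0) ^ 2 + q (ℓ, 1) ^ 2 + q (ℓ, 2) ^ 2)) * q (ℓ, 0),
            c' * Real.sinc (c' * Real.sqrt (q (ℓ, 0) ^ 2 + q (ℓ, 1) ^ 2 + q (ℓ, 2) ^ 2)) * q (ℓ, 1),
            c' * Real.sinc (c' * Real.sqrt (q (ℓ, 0) ^ 2 + q (ℓ, 1) ^ 2 + q (ℓ, 2) ^ 2)) * q (ℓ, 2)])) p * V) := fun c' p V => by
    rw [hRapply]
    exact su2Drift_su2MomRot_mul_gaugeTransform h c' p V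
  have hFΘ : ∀ V : GaugeConfig d L (Matrix.specialUnitaryGroup (Fin 2) ℂ), F ((Elitzur.gaugeTransformMEquiv h) V) = (Elitzur.gaugeTransformMEquiv h) (F V) :=
    fun V => hF h V
  have hSΘ : ∀ V : GaugeConfig d L (Matrix.specialUnitaryGroup (Fin 2) ℂ), S ((Elitzur.gaugeTransformMEquiv h) V) = S V := fun V => hSi h V
  have hJΘ : ∀ V : GaugeConfig d L (Matrix.specialUnitaryGroup (Fin 2) ℂ), J ((Elitzur.gaugeTransformMEquiv h) V) = J V := fun V => hJ h V
  have hTR : ∀ p : ((Edge d L × Fin 3) → ℝ), (fun p : ((Edge d L × Fin 3) → ℝ) => ∑ i, p i ^ 2 / 2) (R p) = (fun p : ((Edge d L × Fin 3) → ℝ) => ∑ i, p i ^ 2 / 2) p := by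
    intro p
    change ∑ i, (R p) i ^ 2 / 2 = ∑ i, p i ^ 2 / 2
    rw [← Finset.sum_div, ← Finset.sum_div, hRapply, sum_sq_su2MomRot]
  have hRν : MeasurePreserving R (volume : Measure ((Edge d L × Fin 3) → ℝ)) volume := measurePreserving_su2MomRot h
  have hg₁Θ : ∀ V : GaugeConfig d L (Matrix.specialUnitaryGroup (Fin 2) ℂ), g₁ ((Elitzur.gaugeTransformMEquiv h) V) = R (g₁ V) := fun V => by
    rw [hRapply]
    exact hgc₁ V
  have hg₂Θ : ∀ V : GaugeConfig d L (Matrix.specialUnitaryGroup (Fin 2) ℂ), g₂ ((Elitzur.gaugeTransformMEquiv h) V) = R (g₂ V) := fun V => by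
    rw [hRapply]
    exact hgc₂ V
  exact gauge_fthmc_omf2_conjKernel_eq_self (Q := GaugeConfig d L (Matrix.specialUnitaryGroup (Fin 2) ℂ)) (P := ((Edge d L × Fin 3) → ℝ)) (ν := (volume : Measure ((Edge d L × Fin 3) → ℝ)))
    (e := fun q : ((Edge d L × Fin 3) → ℝ) =>
                    fun ℓ : Edge d L => gaussUnit (toLp 2
          ![Real.cos (c * Real.sqrt (q (ℓ, 0) ^ 2 + q (ℓ, 1) ^ 2 + q (ℓ, 2) ^ 2)),
            c * Real.sinc (c * Real.sqrt (q (ℓ, 0) ^ 2 + q (ℓ, 1) ^ 2 + q (ℓ, 2) ^ 2)) * q (ℓ, 0),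
            c * Real.sinc (c * Real.sqrt (q (ℓ, 0) ^ 2 + q (ℓ, 1) ^ 2 + q (ℓ, 2) ^ 2)) * q (ℓ, 1),
            c * Real.sinc (c * Real.sqrt (q (ℓ, 0) ^ 2 + q (ℓ, 1) ^ 2 + q (ℓ, 2) ^ 2)) * q (ℓ, 2)]))
    (g₁ := g₁) (g₂ := g₂) (S := S) (T := fun p : ((Edge d L × Fin 3) → ℝ) => ∑ i, p i ^ 2 / 2) (J := J) n
    hS measurable_piGaussianKinetic F hJm (Elitzur.gaugeTransformMEquiv h) R hRneg hRadd (he c) hg₁Θ hg₂Θ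
    hFΘ hSΘ hJΘ hTR hRν

/-- **OMF2 with the exact-gradient forces `κ₁ ∇S̃`, `κ₂ ∇S̃` — no force hypothesis left**
(`S̃ = S∘F − log J` continuous; any `c`, `κ₁`, `κ₂`, `n`, `h`). -/
theorem su2_fthmc_omf2_exactForce_conjKernel_gaugeTransform (h : Site d L → Matrix.specialUnitaryGroup (Fin 2) ℂ)
    (F : GaugeConfig d L (Matrix.specialUnitaryGroup (Fin 2) ℂ) ≃ᵐ GaugeConfig d L (Matrix.specialUnitaryGroup (Fin 2) ℂ)) (hF : IsGaugeEquivariant (⇑F))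
    {J : GaugeConfig d L (Matrix.specialUnitaryGroup (Fin 2) ℂ) → ℝ} (hJm : Measurable J) (hJ : IsGaugeInvariant J)
    {S : GaugeConfig d L (Matrix.specialUnitaryGroup (Fin 2) ℂ) → ℝ} (hS : Measurable S) (hSi : IsGaugeInvariant S)
    (hSc : Continuous fun W : GaugeConfig d L (Matrix.specialUnitaryGroup (Fin 2) ℂ) => S (F W) - Real.log (J W)) (c κ₁ κ₂ : ℝ) (n : ℕ) :
    conjKernel
      (conjKernel
        (refreshUpdate
          (involMH
            (⇑((flip : Equiv.Perm (GaugeConfig d L (Matrix.specialUnitaryGroup (Fin 2) ℂ) × ((Edge d L × Fin 3) → ℝ))) *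
                omf2Word (fun V : GaugeConfig d L (Matrix.specialUnitaryGroup (Fin 2) ℂ) => (fun q : Edge d L × Fin 3 => κ₁ * fderiv ℝ (fun p : ((Edge d L × Fin 3) → ℝ) => (fun W : GaugeConfig d L (Matrix.specialUnitaryGroup (Fin 2) ℂ) => S (F W) - Real.log (J W)) ((fun ℓ : Edge d L => gaussUnit (toLp 2
          ![Real.cos (c * Real.sqrt (p (ℓ, 0) ^ 2 + p (ℓ, 1) ^ 2 + p (ℓ, 2) ^ 2)),
            c * Real.sinc (c * Real.sqrt (p (ℓ, 0) ^ 2 + p (ℓ, 1) ^ 2 + p (ℓ, 2) ^ 2)) * p (ℓ, 0),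
            c * Real.sinc (c * Real.sqrt (p (ℓ, 0) ^ 2 + p (ℓ, 1) ^ 2 + p (ℓ, 2) ^ 2)) * p (ℓ, 1),
            c * Real.sinc (c * Real.sqrt (p (ℓ, 0) ^ 2 + p (ℓ, 1) ^ 2 + p (ℓ, 2) ^ 2)) * p (ℓ, 2)])) * V)) 0 (Pi.single q 1))) (mulDrift fun q : ((Edge d L × Fin 3) → ℝ) =>
                    fun ℓ : Edge d L => gaussUnit (toLp 2
          ![Real.cos (c * Real.sqrt (q (ℓ, 0) ^ 2 + q (ℓ, 1) ^ 2 + q (ℓ, 2) ^ 2)),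
            c * Real.sinc (c * Real.sqrt (q (ℓ, 0) ^ 2 + q (ℓ, 1) ^ 2 + q (ℓ, 2) ^ 2)) * q (ℓ, 0),
            c * Real.sinc (c * Real.sqrt (q (ℓ, 0) ^ 2 + q (ℓ, 1) ^ 2 + q (ℓ, 2) ^ 2)) * q (ℓ, 1),
            c * Real.sinc (c * Real.sqrt (q (ℓ, 0) ^ 2 + q (ℓ, 1) ^ 2 + q (ℓ, 2) ^ 2)) * q (ℓ, 2)])) (fun V : GaugeConfig d L (Matrix.specialUnitaryGroup (Fin 2) ℂ) => (fun q : Edge d L × Fin 3 => κ₂ * fderiv ℝ (fun p : ((Edge d L × Fin 3) → ℝ) => (fun W : GaugeConfig d L (Matrix.specialUnitaryGroup (Fin 2) ℂ) => S (F W) - Real.log (J W)) ((fun ℓ : Edge d L => gaussUnit (toLp 2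
          ![Real.cos (c * Real.sqrt (p (ℓ, 0) ^ 2 + p (ℓ, 1) ^ 2 + p (ℓ, 2) ^ 2)),
            c * Real.sinc (c * Real.sqrt (p (ℓ, 0) ^ 2 + p (ℓ, 1) ^ 2 + p (ℓ, 2) ^ 2)) * p (ℓ, 0),
            c * Real.sinc (c * Real.sqrt (p (ℓ, 0) ^ 2 + p (ℓ, 1) ^ 2 + p (ℓ, 2) ^ 2)) * p (ℓ, 1),
            c * Real.sinc (c * Real.sqrt (p (ℓ, 0) ^ 2 + p (ℓ, 1) ^ 2 + p (ℓ, 2) ^ 2)) * p (ℓ, 2)])) * V)) 0 (Pi.single q 1))) ^ n))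
            (measurable_flip_omf2Word_pow (measurable_su2Drift c) (measurable_su2ExactForce hSc c κ₁) (measurable_su2ExactForce hSc c κ₂) n)
            fun z : GaugeConfig d L (Matrix.specialUnitaryGroup (Fin 2) ℂ) × ((Edge d L × Fin 3) → ℝ) => (S (F z.1) - Real.log (J z.1)) + ∑ i, z.2 i ^ 2 / 2)
          ((((volume : Measure ((Edge d L × Fin 3) → ℝ)).withDensity
                  fun p => ENNReal.ofReal (Real.exp (-(∑ i, p i ^ 2 / 2)))) Set.univ)⁻¹ •
              (volume : Measure ((Edge d L × Fin 3) → ℝ)).withDensity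
                fun p => ENNReal.ofReal (Real.exp (-(∑ i, p i ^ 2 / 2)))))
        F)
      (Elitzur.gaugeTransformMEquiv h) =
      (conjKernel
        (refreshUpdate
          (involMH
            (⇑((flip : Equiv.Perm (GaugeConfig d L (Matrix.specialUnitaryGroup (Fin 2) ℂ) × ((Edge d L × Fin 3) → ℝ))) *
                omf2Word (fun V : GaugeConfig d L (Matrix.specialUnitaryGroup (Fin 2) ℂ) => (fun q : Edge d L × Fin 3 => κ₁ * fderiv ℝ (fun p : ((Edge d L × Fin 3) → ℝ) => (fun W : GaugeConfig d L (Matrix.specialUnitaryGroup (Fin 2) ℂ) => S (F W) - Real.log (J W)) ((fun ℓ : Edge d L => gaussUnit (toLp 2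
          ![Real.cos (c * Real.sqrt (p (ℓ, 0) ^ 2 + p (ℓ, 1) ^ 2 + p (ℓ, 2) ^ 2)),
            c * Real.sinc (c * Real.sqrt (p (ℓ, 0) ^ 2 + p (ℓ, 1) ^ 2 + p (ℓ, 2) ^ 2)) * p (ℓ, 0),
            c * Real.sinc (c * Real.sqrt (p (ℓ, 0) ^ 2 + p (ℓ, 1) ^ 2 + p (ℓ, 2) ^ 2)) * p (ℓ, 1),
            c * Real.sinc (c * Real.sqrt (p (ℓ, 0) ^ 2 + p (ℓ, 1) ^ 2 + p (ℓ, 2) ^ 2)) * p (ℓ, 2)])) * V)) 0 (Pi.single q 1))) (mulDrift fun q : ((Edge d L × Fin 3) → ℝ) =>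
                    fun ℓ : Edge d L => gaussUnit (toLp 2
          ![Real.cos (c * Real.sqrt (q (ℓ, 0) ^ 2 + q (ℓ, 1) ^ 2 + q (ℓ, 2) ^ 2)),
            c * Real.sinc (c * Real.sqrt (q (ℓ, 0) ^ 2 + q (ℓ, 1) ^ 2 + q (ℓ, 2) ^ 2)) * q (ℓ, 0),
            c * Real.sinc (c * Real.sqrt (q (ℓ, 0) ^ 2 + q (ℓ, 1) ^ 2 + q (ℓ, 2) ^ 2)) * q (ℓ, 1),
            c * Real.sinc (c * Real.sqrt (q (ℓ, 0) ^ 2 + q (ℓ, 1) ^ 2 + q (ℓ, 2) ^ 2)) * q (ℓ, 2)])) (fun V : GaugeConfig d L (Matrix.specialUnitaryGroup (Fin 2) ℂ) => (fun q : Edge d L × Fin 3 => κ₂ * fderiv ℝ (fun p : ((Edge d L × Fin 3) → ℝ) => (fun W : GaugeConfig d L (Matrix.specialUnitaryGroup (Fin 2) ℂ) => S (F W) - Real.log (J W)) ((fun ℓ : Edge d L => gaussUnit (toLp 2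
          ![Real.cos (c * Real.sqrt (p (ℓ, 0) ^ 2 + p (ℓ, 1) ^ 2 + p (ℓ, 2) ^ 2)),
            c * Real.sinc (c * Real.sqrt (p (ℓ, 0) ^ 2 + p (ℓ, 1) ^ 2 + p (ℓ, 2) ^ 2)) * p (ℓ, 0),
            c * Real.sinc (c * Real.sqrt (p (ℓ, 0) ^ 2 + p (ℓ, 1) ^ 2 + p (ℓ, 2) ^ 2)) * p (ℓ, 1),
            c * Real.sinc (c * Real.sqrt (p (ℓ, 0) ^ 2 + p (ℓ, 1) ^ 2 + p (ℓ, 2) ^ 2)) * p (ℓ, 2)])) * V)) 0 (Pi.single q 1))) ^ n))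
            (measurable_flip_omf2Word_pow (measurable_su2Drift c) (measurable_su2ExactForce hSc c κ₁) (measurable_su2ExactForce hSc c κ₂) n)
            fun z : GaugeConfig d L (Matrix.specialUnitaryGroup (Fin 2) ℂ) × ((Edge d L × Fin 3) → ℝ) => (S (F z.1) - Real.log (J z.1)) + ∑ i, z.2 i ^ 2 / 2)
          ((((volume : Measure ((Edge d L × Fin 3) → ℝ)).withDensity
                  fun p => ENNReal.ofReal (Real.exp (-(∑ i, p i ^ 2 / 2)))) Set.univ)⁻¹ •
              (volume : Measure ((Edge d L × Fin 3) → ℝ)).withDensity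
                fun p => ENNReal.ofReal (Real.exp (-(∑ i, p i ^ 2 / 2)))))
        F) :=
  su2_fthmc_omf2_conjKernel_gaugeTransform h F hF hJm hJ hS hSi c
    (measurable_su2ExactForce hSc c κ₁) (measurable_su2ExactForce hSc c κ₂)
    (fun V => su2ExactForce_gaugeTransform h (isGaugeInvariant_ftAction hSi hF hJ) c κ₁ V)
    (fun V => su2ExactForce_gaugeTransform h (isGaugeInvariant_ftAction hSi hF hJ) c κ₂ V) n

end Summit.Ventures.LatticeQCDFlow.Exactness
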